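import Literature.InformationTheory.QuantumCodes.MaximumLikelihoodDecoding
import Literature.InformationTheory.QuantumCodes.BitFlipDegradation
import HarnessLib

/-!
# The optimal (maximum-likelihood) failure probability is monotone in the flip rate on `[0, 1/2]`

Topic `Literature/InformationTheory/QuantumCodes` (venture QEC, LADDER-QEC rung Q5; qec-lit-2 gen 5). Theorem-only
assembly of `MaximumLikelihoodDecoding.lean` (the optimum `Decoder.optimalFailureMass` is attained and is `≤` the
failure mass of every decoder; Dennis–Kitaev–Landahl–Preskill 2002 §4.3, Bravyi–Suchara–Vargo 2014 §1–2) and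
`BitFlipDegradation.lean` (the bit-flip family is ordered by degradation: for `p ≤ p' ≤ 1/2` every decoder at rate
`p'` is matched at rate `p` by some decoder; Richardson–Urbanke 2008 Example 4.71):

* `Decoder.optimalFailureMass_flip_mono`: for independent flips on `𝔽₂^V`, an additive syndrome map and any trivial
  set, `p ≤ p' ≤ 1/2 ⇒ optimum(p) ≤ optimum(p')` ("the error probability of the [degraded] channel cannot be smaller",
  RU Def 4.69, for the best decoder of each);
* CSS sectors: `CSSCode.zOptimalFailure_mono`, `CSSCode.xOptimalFailure_mono`.

Consequence (packaged problem-side in `Summits/Ventures/QEC/Thresholds/OptimalDecoderThresholds.lean`): for the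
OPTIMAL decoder the set of below-threshold rates in `[0, 1/2]` is an initial segment, so DKLP's `p_c` is a threshold
in the strict sense (`CodeCapacityNoise.lean`, design note (1), asked exactly this for a general recovery procedure;
for a fixed non-optimal decoder it can fail). No definition, no named fact, kernel axioms.

## References

* [RichardsonUrbanke2008] T. Richardson, R. Urbanke, *Modern Coding Theory*, CUP 2008, §4.1.11 Definition 4.69 (with the
  Discussion: degradation cannot decrease the error probability) and Example 4.71 (the family {BSC(ε)} is ordered by
  degradation).
* [DennisEtAl2002] E. Dennis, A. Kitaev, A. Landahl, J. Preskill, J. Math. Phys. 43 (2002) 4452, §4.3 (optimal recovery),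
  §4.6 (`p_c`).
-/

namespace Literature.InformationTheory.QuantumCodes

open Finset Matrix

namespace Decoder

variable {V : Type*} [Fintype V] [DecidableEq V] {Syn : Type*} [AddCommGroup Syn]

open Classical in
/-- **The optimal failure probability is monotone in the flip rate on `[0, 1/2]`**: for an additive syndrome map on
`𝔽₂^V`, any trivial set `S` and `p ≤ p' ≤ 1/2`, the least failure mass over all decoders at rate `p` is at most that
at rate `p'` (degrade `BSC(p)` to `BSC(p')` inside the decoder; the optimum is attained and beats every decoder).
[cite: RichardsonUrbanke2008, Definition 4.69 and Example 4.71] -/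
theorem optimalFailureMass_flip_mono {syn : (V → ZMod 2) → Syn} (hsyn : ∀ a b, syn (a + b) = syn a + syn b)
    (S : Set (V → ZMod 2)) {p p' : ℝ} (hpp' : p ≤ p') (hp' : p' ≤ 1 / 2) :
    optimalFailureMass (fun e : V → ZMod 2 => bernoulliWeight p (supp e)) syn S ≤
      optimalFailureMass (fun e : V → ZMod 2 => bernoulliWeight p' (supp e)) syn S := by
  obtain ⟨D', _, hD'⟩ := exists_failureMass_eq_optimal (fun e : V → ZMod 2 => bernoulliWeight p' (supp e)) syn S
  obtain ⟨D, hD⟩ := exists_failure_le_of_le D' hsyn S hpp' hp'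
  have h1 := optimalFailureMass_le (fun e : V → ZMod 2 => bernoulliWeight p (supp e)) syn S D
  rw [← hD']
  exact h1.trans hD

end Decoder

namespace CSSCode

variable {RX RZ V : Type*} [Fintype V] [DecidableEq V]

/-- **`Z`-sector: the optimal failure probability is monotone on `[0, 1/2]`**:
`p ≤ p' ≤ 1/2 ⇒ zOptimalFailure C p ≤ zOptimalFailure C p'`. [cite: RichardsonUrbanke2008, Example 4.71 (the family {BSC(ε)} is ordered by degradation)] -/
theorem zOptimalFailure_mono [Fintype RZ] (C : CSSCode RX RZ V) {p p' : ℝ} (hpp' : p ≤ p') (hp' : p' ≤ 1 / 2) :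
    C.zOptimalFailure p ≤ C.zOptimalFailure p' :=
  Decoder.optimalFailureMass_flip_mono (fun a b => by simp [zSyndrome, Matrix.mulVec_add]) _ hpp' hp'

/-- **`X`-sector: the optimal failure probability is monotone on `[0, 1/2]`.**
[cite: RichardsonUrbanke2008, Example 4.71 (the family {BSC(ε)} is ordered by degradation)] -/
theorem xOptimalFailure_mono [Fintype RX] (C : CSSCode RX RZ V) {p p' : ℝ} (hpp' : p ≤ p') (hp' : p' ≤ 1 / 2) :
    C.xOptimalFailure p ≤ C.xOptimalFailure p' :=
  Decoder.optimalFailureMass_flip_mono (fun a b => by simp [xSyndrome, Matrix.mulVec_add]) _ hpp' hp'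

end CSSCode

end Literature.InformationTheory.QuantumCodes
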